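import Summits.BirchSwinnertonDyer.BirchSwinnertonDyer.Theorems.GenusKolyvaginAtTwoEquivariantChebotarevAtTwoSignedStepB
import Summits.BirchSwinnertonDyer.BirchSwinnertonDyer.Theorems.GenusKolyvaginAtTwoEquivariantChebotarevAtTwoOfGaloisElement
import Summits.BirchSwinnertonDyer.BirchSwinnertonDyer.Theorems.GenusKolyvaginAtTwoEquivariantChebotarevAtTwoOffDiscField

/-!
# Route `GenusKolyvaginAtTwo`, LINE 6 of crux `KolyvaginExactAtTwo` (22137), key child Q3′
# (stmt-BirchSwinnertonDyer-24882): McCallum's Cor. 3.2 at `p = 2` for SIGNED-stable families,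
# UNCONDITIONAL — the Čebotarev input of Kolyvagin's descent over `ℚ` for the pair `(E, E^{(d_K)})`
# (helper, PROVED; seat `bsd-line-gk2-p2` g9, cell `bsd-f1-sign2`)

Assembly of the two siblings `…SignedStepB` (signed Step B) and `…OfGaloisElement` (Steps C–H):
* `exists_kolyvaginPrime_gt_two_signStable`, `setInfinite_kolyvaginPrime_two_signStable` — Cor. 3.2
  at `2` for a family with `c_* c_i = s_i • c_{π i}` (`s_i = ±1`, `π` an involution), modulo the
  displayed Čebotarev and image inputs (`hC`, `hS`, `hCe`, `hfree₀`), exactly as the `τ`-stable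
  `…tauStable` theorems of `…OfChebotarev`;
* `equivariantChebotarevAtTwo_signed_of_image` — the binders of
  `equivariantChebotarevAtTwo_of_chebotarev_of_image` (Q5's, with `hC`, `hS`, `hCe`) plus
  `(sgn, hsgn, hsgnπ)`; `π` an involution is DERIVED (`c_*² = 1`, `s_i s_{π i} = 1`, injectivity of
  an independent family);
* **`equivariantChebotarevAtTwo_signed_of_not_isSquare`** — the binders of Q5′
  (`equivariantChebotarevAtTwo_of_not_isSquare`: Q5 + the parent's `¬ IsSquare (d_K · (−|Δ_E|))`)
  VERBATIM with `(sgn, hsgn, hsgnπ)` inserted after `π` and the stability hypothesis signed —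
  UNCONDITIONAL (Čebotarev = tree theorem `Automorphic.chebotarev_artinRep_of_galoisSide`; image from
  `d_K · Δ ∉ ℚ²` and `ρ̄_{E,2}` onto; `hfree₀` from Q1 on `Δ < 0`);
* **`equivariantChebotarevAtTwo_eigen_of_not_isSquare`** — `π = id`: a family of `c_*`-EIGENCLASSES
  of both signs (`c_* c_i = ± c_i`) — McCallum's printed Cor. 3.2 ("independent eigenclasses") at
  `p = 2` on `Δ(E) < 0`, `K ≠ ℚ(√Δ_E)`, `ρ_{E,2^∞}` onto; this is the `cebotarev` field of
  `KolyvaginDescent.SplitHypothesesM` (S7, p622894) for the pair `(E, E^{(d_K)})` over `ℚ`, in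
  `K_λ`-currency (invariant classes = restrictions from `E`, anti-invariant = from `E^{(d_K)}`;
  transfer `K_λ → ℚ_ℓ` by the injective restriction on `Δ < 0`, seat gk2-p3's `…InfResIndexTwo`).

Helper for 24882 (`--supports`); closes nothing; 0 sorry, standard axioms. BSD is not proved by any
of this.

References: [McCallumLMS1991] §3 (2), Prop. 3.1, Cor. 3.2; [GrossLMS1991] §9; [Kolyvagin1989Izv] §3;
[WZhang2014] Notations (xii).
-/

set_option autoImplicit false
set_option linter.dupNamespace false

noncomputable section

open scoped Classical Pointwise

namespace Summit.BirchSwinnertonDyer.BirchSwinnertonDyer.Theorems.GenusExact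

open WeierstrassCurve NumberField IsDedekindDomain Field Finset
open Literature.NumberTheory.GaloisRepresentations Literature.NumberTheory.EllipticCurves
open Literature.NumberTheory
open Rat.HeightOneSpectrum
open Summit.BirchSwinnertonDyer.BirchSwinnertonDyer.Theorems.KolyvaginEigenTwo
  (exists_twoTorsion_smul_ne_of_Δ_neg)

universe u v

variable {W : WeierstrassCurve ℚ} {K : Type u} [Field K] [NumberField K]

/-! ### §4 Cor. 3.2 at `2` for a signed-stable family -/

set_option maxHeartbeats 800000 in
/-- **One Kolyvagin prime at `2` of level `2^M` above any bound, with prescribed local orders, for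
a SIGNED-stable independent family** (McCallum 1991 Prop. 3.1 / Cor. 3.2 at `p = 2`; signed form of
`exists_kolyvaginPrime_gt_two_tauStable`). Hypotheses as there, with `c_* c_i = s_i • c_{π i}`,
`s_i = ±1`, in place of `c_* c_i = c_{π i}`. [cite: McCallumLMS1991, §3 Cor. 3.2 (proof, with Prop. 3.1)]
[cite: GrossLMS1991, §3 (3.3)] -/
theorem exists_kolyvaginPrime_gt_two_signStable (hC : Automorphic.chebotarev_artinRep) {N : ℕ}
    [NeZero N] [W.IsElliptic] [W.IsGloballyMinimal] (hK : IsImaginaryQuadratic K) {M : ℕ}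
    (hM : 1 ≤ M)
    (hS : ∀ H : AddSubgroup (geomTorsion (W.baseChange K) 2),
      (∀ g : absoluteGaloisGroup K, ∀ t ∈ H, g • t ∈ H) → H = ⊥ ∨ H = ⊤)
    (hCe : ∀ f : geomTorsion (W.baseChange K) 2 →+ geomTorsion (W.baseChange K) 2,
      (∀ (g : absoluteGaloisGroup K) (t : geomTorsion (W.baseChange K) 2), f (g • t) = g • f t) →
        ∃ k : ℤ, ∀ t, f t = k • t)
    {c₀ : absoluteGaloisGroup ℚ} (hc₀ : IsComplexConjugation (Rat.castHom ℝ) c₀)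
    {P₀ : geomTorsion W ((2 ^ M : ℕ) : ℤ)}
    (hfree₀ : ∀ a b : ℤ, a • P₀ + b • (c₀ • P₀) = 0 → (2 : ℤ) ^ M ∣ a ∧ (2 : ℤ) ^ M ∣ b)
    {c : K ≃ₐ[ℚ] K} (hc : c ≠ 1) {r : ℕ}
    (cs : Fin r → galH1Torsion (W.baseChange K) ((2 ^ M : ℕ) : ℤ)) {π : Fin r → Fin r}
    (hπ : ∀ i, π (π i) = i) {sgn : Fin r → ℤ} (hsgn : ∀ i, sgn i = 1 ∨ sgn i = -1)
    (hτs : ∀ i, conjAct W c ((2 ^ M : ℕ) : ℤ) (cs i) = sgn i • cs (π i))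
    (ex : Fin r → ℕ) (hex : ∀ i, ((2 : ℤ) ^ ex i) • cs i = 0) (hexM : ∀ i, ex i ≤ M)
    (hind : ∀ a : Fin r → ℤ, ∑ i, a i • cs i = 0 → ∀ i, ((2 : ℤ) ^ ex i) ∣ a i)
    (hres : ∀ a : Fin r → ℤ, (∀ ρ ∈ torsionFixing (W.baseChange K) ((2 ^ M : ℕ) : ℤ),
      h1Eval (W.baseChange K) ((2 ^ M : ℕ) : ℤ) (∑ i, a i • cs i) ρ = 0) → ∑ i, a i • cs i = 0)
    (Nv : Fin r → ℕ) (hNe : ∀ i, Nv i ≤ ex i) (hNπ : ∀ i, Nv (π i) = Nv i) (b : ℕ) :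
    ∃ ℓ : ℕ, b < ℓ ∧ ℓ.Prime ∧ ¬ ℓ ∣ N ∧ ¬ ((ℓ : ℤ) ∣ NumberField.discr K) ∧ ℓ ≠ 2 ∧
      (Ideal.span {(ℓ : 𝓞 K)}).IsPrime ∧ FrobEqFrobInfty W K (2 ^ M) ℓ ∧
      2 ^ M ∣ ℓ + 1 ∧ ((2 : ℤ) ^ M) ∣ W.frobeniusTrace ℓ ∧
      ∀ i, ∀ v : HeightOneSpectrum (𝓞 K), (ℓ : 𝓞 K) ∈ v.asIdeal →
        (((2 : ℤ) ^ Nv i) • cs i ∈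
            (W.baseChange K).torsionLocalKer (v.adicCompletion K) ((2 ^ M : ℕ) : ℤ) ∧
          (Nv i ≠ 0 → ((2 : ℤ) ^ (Nv i - 1)) • cs i ∉
            (W.baseChange K).torsionLocalKer (v.adicCompletion K) ((2 ^ M : ℕ) : ℤ))) := by
  classical
  have hp : Nat.Prime 2 := Nat.prime_two
  have h2n : (2 : ℤ) ∣ ((2 ^ M : ℕ) : ℤ) := by
    rw [Nat.cast_pow]; exact dvd_pow_self _ (by omega)
  -- ### Step A: the involutive lift of complex conjugation and the free generator on `E(K̄)[2^M]`
  set t : AlgebraicClosure K ≃+* AlgebraicClosure K :=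
    (absGaloisTransport (K := ℚ) (L := K) c₀).toRingEquiv with ht_def
  have ht : IsLiftOfAut c t :=
    RatClosure.isLiftOfAut_absGaloisTransport_of_isImaginaryQuadratic hK hc hc₀
  have hinv : ∀ x, t (t x) = x := fun x ↦
    RatClosure.absGaloisTransport_absGaloisTransport_of_sq_eq_one hc₀.sq_eq_one x
  set θ := RatClosure.torsionEquiv (K := K) W ((2 ^ M : ℕ) : ℤ) with hθ
  have hθc : ht.torsionMap W ((2 ^ M : ℕ) : ℤ) (θ P₀) = θ (c₀ • P₀) := by
    rw [← RatClosure.torsionEquiv_smul_of_lift W ht c₀ (fun _ ↦ rfl) _ P₀]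
  have hPM : (2 : ℤ) ^ M • θ P₀ = 0 := by
    apply Subtype.ext
    rw [AddSubgroupClass.coe_zsmul, ZeroMemClass.coe_zero]
    have := (mem_geomTorsion_iff (W.baseChange K) _ ((θ P₀ : geomTorsion (W.baseChange K) _) :
      geomPoints (W.baseChange K))).mp (θ P₀).2
    exact_mod_cast this
  have hfree : ∀ a b : ℤ, a • θ P₀ + b • ht.torsionMap W ((2 ^ M : ℕ) : ℤ) (θ P₀) = 0 →
      (2 : ℤ) ^ M ∣ a ∧ (2 : ℤ) ^ M ∣ b := by
    intro a b' hab
    rw [hθc, ← map_zsmul, ← map_zsmul, ← map_add, map_eq_zero_iff _ θ.injective] at hab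
    exact hfree₀ a b' hab
  -- ### Step B (signed): the choice of `ρ`
  have hρex := exists_h1Eval_conj_mul_order_signStable W ht hinv h2n hS hCe hPM hfree hπ hsgn
    hτs ex hex hind hres Nv hNe hexM hNπ
  -- ### Steps C–H
  exact exists_kolyvaginPrime_gt_two_of_galoisElement (N := N) hC hK hM hc₀ hc cs Nv hρex b


/-! ### §5 The `Set.Infinite` form and Q5′'s binders, signed -/

/-- **The `Set.Infinite` form with Q5's local clause, signed family.** Under the hypotheses of
`exists_kolyvaginPrime_gt_two_signStable`: infinitely many primes `ℓ` with `Frob(ℓ) = Frob(∞)` on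
`K(E[2^M])`, `ℓ` a Kolyvagin prime at `2` in Zhang's sense with `M ≤ M(ℓ)`, and, at the place
`λ ∋ ℓ`, `2^j c_{i,λ} = 0 ↔ N_i ≤ j` for every `i`, `j`. [cite: McCallumLMS1991, §3 Cor. 3.2]
[cite: WZhang2014, Notations (xii)] -/
theorem setInfinite_kolyvaginPrime_two_signStable (hC : Automorphic.chebotarev_artinRep) {N : ℕ}
    [NeZero N] [W.IsElliptic] [W.IsGloballyMinimal] (hK : IsImaginaryQuadratic K) {M : ℕ}
    (hM : 1 ≤ M)
    (hS : ∀ H : AddSubgroup (geomTorsion (W.baseChange K) 2),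
      (∀ g : absoluteGaloisGroup K, ∀ t ∈ H, g • t ∈ H) → H = ⊥ ∨ H = ⊤)
    (hCe : ∀ f : geomTorsion (W.baseChange K) 2 →+ geomTorsion (W.baseChange K) 2,
      (∀ (g : absoluteGaloisGroup K) (t : geomTorsion (W.baseChange K) 2), f (g • t) = g • f t) →
        ∃ k : ℤ, ∀ t, f t = k • t)
    {c₀ : absoluteGaloisGroup ℚ} (hc₀ : IsComplexConjugation (Rat.castHom ℝ) c₀)
    {P₀ : geomTorsion W ((2 ^ M : ℕ) : ℤ)}
    (hfree₀ : ∀ a b : ℤ, a • P₀ + b • (c₀ • P₀) = 0 → (2 : ℤ) ^ M ∣ a ∧ (2 : ℤ) ^ M ∣ b)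
    {c : K ≃ₐ[ℚ] K} (hc : c ≠ 1) {r : ℕ}
    (cs : Fin r → galH1Torsion (W.baseChange K) ((2 ^ M : ℕ) : ℤ)) {π : Fin r → Fin r}
    (hπ : ∀ i, π (π i) = i) {sgn : Fin r → ℤ} (hsgn : ∀ i, sgn i = 1 ∨ sgn i = -1)
    (hτs : ∀ i, conjAct W c ((2 ^ M : ℕ) : ℤ) (cs i) = sgn i • cs (π i))
    (ex : Fin r → ℕ) (hex : ∀ i, ((2 : ℤ) ^ ex i) • cs i = 0) (hexM : ∀ i, ex i ≤ M)
    (hind : ∀ a : Fin r → ℤ, ∑ i, a i • cs i = 0 → ∀ i, ((2 : ℤ) ^ ex i) ∣ a i)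
    (hres : ∀ a : Fin r → ℤ, (∀ ρ ∈ torsionFixing (W.baseChange K) ((2 ^ M : ℕ) : ℤ),
      h1Eval (W.baseChange K) ((2 ^ M : ℕ) : ℤ) (∑ i, a i • cs i) ρ = 0) → ∑ i, a i • cs i = 0)
    (Nv : Fin r → ℕ) (hNe : ∀ i, Nv i ≤ ex i) (hNπ : ∀ i, Nv (π i) = Nv i) :
    Set.Infinite {ℓ : ℕ | FrobEqFrobInfty W K (2 ^ M) ℓ ∧ Zhang2014.IsKolyvaginPrime N W K 2 ℓ ∧
      M ≤ Zhang2014.kolyvaginIndex W 2 ℓ ∧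
      ∀ i, ∀ v : HeightOneSpectrum (𝓞 K), (ℓ : 𝓞 K) ∈ v.asIdeal → ∀ j : ℕ,
        ((2 ^ j : ℕ) : ℤ) • cs i ∈
            (W.baseChange K).torsionLocalKer (v.adicCompletion K) ((2 ^ M : ℕ) : ℤ) ↔ Nv i ≤ j} := by
  haveI : Fact (Nat.Prime 2) := ⟨Nat.prime_two⟩
  refine Set.infinite_of_forall_exists_gt fun b ↦ ?_
  obtain ⟨ℓ, hbℓ, hℓ, hℓN, hℓD, hℓ2, hprime, h32, hdvd1, hdvd2, hloc⟩ :=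
    exists_kolyvaginPrime_gt_two_signStable (N := N) hC hK hM hS hCe hc₀ hfree₀ hc cs hπ hsgn hτs ex
      hex hexM hind hres Nv hNe hNπ b
  have hidx : M ≤ Zhang2014.kolyvaginIndex W 2 ℓ :=
    Zhang2014.le_kolyvaginIndex_iff.mpr ⟨hdvd1, hdvd2⟩
  refine ⟨ℓ, ⟨h32, ⟨hℓ, hℓN, hℓD, hℓ2, hprime, lt_of_lt_of_le (by omega) hidx⟩, hidx,
    fun i v hv j ↦ ?_⟩, hbℓ⟩
  obtain ⟨hA, hB⟩ := hloc i v hv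
  have h2j : ((2 ^ j : ℕ) : ℤ) • cs i = ((2 : ℤ) ^ j) • cs i :=
    congrArg (fun z : ℤ ↦ z • cs i) (by push_cast; rfl)
  rw [h2j]
  constructor
  · intro hj
    by_contra hlt
    have hlt' : j < Nv i := Nat.lt_of_not_le hlt
    apply hB (by omega)
    have : ((2 : ℤ) ^ (Nv i - 1)) • cs i = ((2 : ℤ) ^ (Nv i - 1 - j)) • (((2 : ℤ) ^ j) • cs i) := by
      rw [smul_smul, ← pow_add, Nat.sub_add_cancel (by omega)]
    rw [this]
    exact AddSubgroup.zsmul_mem _ hj _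
  · intro hj
    have : ((2 : ℤ) ^ j) • cs i = ((2 : ℤ) ^ (j - Nv i)) • (((2 : ℤ) ^ Nv i) • cs i) := by
      rw [smul_smul, ← pow_add, Nat.sub_add_cancel hj]
    rw [this]
    exact AddSubgroup.zsmul_mem _ hA _


set_option maxHeartbeats 800000 in
/-- **Q5′ signed, modulo Čebotarev and the image of `Γ_K` on `E[2]`.** The binders of
`equivariantChebotarevAtTwo_of_chebotarev_of_image` (= those of the route decl
`Theses.GenusKolyvaginAtTwo.EquivariantChebotarevAtTwo` with `hC`, `hS`, `hCe`) with signs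
`sgn i = ±1`, `sgn (π i) = sgn i` inserted after `π` and the stability hypothesis signed:
`c_* c_i = sgn i • c_{π i}`. [cite: McCallumLMS1991, §3 Cor. 3.2] [cite: GrossLMS1991, §9]
[cite: WZhang2014, Notations (xii)] -/
theorem equivariantChebotarevAtTwo_signed_of_image (hC : Automorphic.chebotarev_artinRep)
    (N : ℕ) [NeZero N] (W : WeierstrassCurve ℚ) [W.IsElliptic] [W.IsGloballyMinimal]
    (_hcm : ¬ W.HasCM) (hΔ : W.Δ < 0) (K : Type) [Field K] [NumberField K]
    (hK : IsImaginaryQuadratic K)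
    (hS : ∀ H : AddSubgroup (geomTorsion (W.baseChange K) 2),
      (∀ g : absoluteGaloisGroup K, ∀ t ∈ H, g • t ∈ H) → H = ⊥ ∨ H = ⊤)
    (hCe : ∀ f : geomTorsion (W.baseChange K) 2 →+ geomTorsion (W.baseChange K) 2,
      (∀ (g : absoluteGaloisGroup K) (t : geomTorsion (W.baseChange K) 2), f (g • t) = g • f t) →
        ∃ k : ℤ, ∀ t, f t = k • t)
    (_hρ : ∀ n : ℕ, W.HasSurjectiveModNGaloisRep (2 ^ n : ℕ)) (c : K ≃ₐ[ℚ] K) (hc : c ≠ 1)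
    (M : ℕ) (hM : 1 ≤ M) (r : ℕ) (cs : Fin r → galH1Torsion (W.baseChange K) ((2 ^ M : ℕ) : ℤ))
    (π : Fin r → Fin r) (sgn : Fin r → ℤ) (hsgn : ∀ i, sgn i = 1 ∨ sgn i = -1)
    (hsgnπ : ∀ i, sgn (π i) = sgn i) (h0 : ∀ i, cs i ≠ 0)
    (hτs : ∀ i, conjAct W c ((2 ^ M : ℕ) : ℤ) (cs i) = sgn i • cs (π i))
    (hind : ∀ a : Fin r → ℤ, ∑ i, a i • cs i = 0 → ∀ i, (addOrderOf (cs i) : ℤ) ∣ a i)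
    (hres : ∀ a : Fin r → ℤ, (∀ ρ ∈ torsionFixing (W.baseChange K) ((2 ^ M : ℕ) : ℤ),
      h1Eval (W.baseChange K) ((2 ^ M : ℕ) : ℤ) (∑ i, a i • cs i) ρ = 0) → ∑ i, a i • cs i = 0)
    (Mi : Fin r → ℕ) (hMi : ∀ i, addOrderOf (cs i) = 2 ^ Mi i) (Nv : Fin r → ℕ)
    (hNe : ∀ i, Nv i ≤ Mi i) (hNπ : ∀ i, Nv (π i) = Nv i) :
    Set.Infinite {ℓ : ℕ | FrobEqFrobInfty W K (2 ^ M) ℓ ∧ Zhang2014.IsKolyvaginPrime N W K 2 ℓ ∧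
      M ≤ Zhang2014.kolyvaginIndex W 2 ℓ ∧
      ∀ i, ∀ v : HeightOneSpectrum (𝓞 K), (ℓ : 𝓞 K) ∈ v.asIdeal → ∀ j : ℕ,
        ((2 ^ j : ℕ) : ℤ) • cs i ∈
            (W.baseChange K).torsionLocalKer (v.adicCompletion K) ((2 ^ M : ℕ) : ℤ) ↔ Nv i ≤ j} := by
  -- ### a complex conjugation and the free generator of `E[2^M]` (Q1 on `Δ < 0`)
  obtain ⟨c₀, hc₀⟩ := exists_isComplexConjugation (Rat.castHom ℝ)
  obtain ⟨v, hv⟩ := exists_twoTorsion_smul_ne_of_Δ_neg W hΔ hc₀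
  have hv2 : (2 : ℤ) • (v : geomPoints W) = 0 := (mem_geomTorsion_iff W 2 (v : geomPoints W)).mp v.2
  have hcv : c₀ • (v : geomPoints W) ≠ (v : geomPoints W) := fun h ↦ hv (Subtype.ext h)
  have hq0 : (((2 ^ (M - 1) : ℕ) : ℤ)) ≠ 0 := by positivity
  obtain ⟨P, hP⟩ := W.zsmul_geomPoints_surjective_of_charZero hq0 (v : geomPoints W)
  have hPv : ((2 ^ (M - 1) : ℕ) : ℤ) • P = (v : geomPoints W) := hP
  have hPM : P ∈ geomTorsion W ((2 ^ M : ℕ) : ℤ) := by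
    rw [mem_geomTorsion_iff]
    have h2M : ((2 ^ M : ℕ) : ℤ) = 2 * ((2 ^ (M - 1) : ℕ) : ℤ) := by
      push_cast
      rw [← pow_succ', Nat.sub_add_cancel hM]
    rw [h2M, mul_smul, hPv, hv2]
  set P₀ : geomTorsion W ((2 ^ M : ℕ) : ℤ) := ⟨P, hPM⟩ with hP₀
  have hfree₀ : ∀ a b : ℤ, a • P₀ + b • (c₀ • P₀) = 0 → (2 : ℤ) ^ M ∣ a ∧ (2 : ℤ) ^ M ∣ b := by
    intro a b hab
    have hab' : a • P + b • (c₀ • P) = 0 := congrArg Subtype.val hab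
    have hPM' : (2 : ℤ) ^ M • P = 0 := by
      have h := (mem_geomTorsion_iff W _ P).mp hPM
      push_cast at h
      exact h
    have hPv' : (2 : ℤ) ^ (M - 1) • P = (v : geomPoints W) := by
      have h := hPv
      push_cast at h
      exact h
    exact pow_dvd_of_zsmul_add_zsmul_smul_eq_zero hv2 hcv M P hPM' hPv' a b hab'
  -- ### `π` is an involution
  have hcc : c * c = 1 := mul_self_eq_one_of_isImaginaryQuadratic hK c
  have hinj : Function.Injective cs := by
    intro i j hij
    by_contra hne
    set a : Fin r → ℤ := Pi.single i 1 - Pi.single j 1 with ha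
    have hai : a i = 1 := by
      rw [ha, Pi.sub_apply, Pi.single_eq_same, Pi.single_eq_of_ne hne, sub_zero]
    have hterm : ∀ k, a k • cs k =
        (Pi.single i 1 : Fin r → ℤ) k • cs k - (Pi.single j 1 : Fin r → ℤ) k • cs k :=
      fun k ↦ by rw [ha, Pi.sub_apply, sub_zsmul, sub_eq_add_neg]
    have hsi : ∑ k, (Pi.single i 1 : Fin r → ℤ) k • cs k = cs i := by
      rw [Finset.sum_eq_single i (fun k _ hk ↦ by rw [Pi.single_eq_of_ne hk, zero_zsmul])
        (fun h ↦ absurd (Finset.mem_univ i) h), Pi.single_eq_same, one_zsmul]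
    have hsj : ∑ k, (Pi.single j 1 : Fin r → ℤ) k • cs k = cs j := by
      rw [Finset.sum_eq_single j (fun k _ hk ↦ by rw [Pi.single_eq_of_ne hk, zero_zsmul])
        (fun h ↦ absurd (Finset.mem_univ j) h), Pi.single_eq_same, one_zsmul]
    have hsum : ∑ k, a k • cs k = 0 := by
      rw [Finset.sum_congr rfl fun k _ ↦ hterm k, Finset.sum_sub_distrib, hsi, hsj, hij, sub_self]
    have hdvd := hind a hsum i
    rw [hai] at hdvd
    have h1 : addOrderOf (cs i) = 1 := by
      have := Int.eq_one_of_dvd_one (by positivity) hdvd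
      exact_mod_cast this
    exact h0 i (AddMonoid.addOrderOf_eq_one_iff.mp h1)
  have hss : ∀ i, sgn i * sgn (π i) = 1 := fun i ↦ by
    rw [hsgnπ]; rcases hsgn i with h | h <;> simp [h]
  have hπ : ∀ i, π (π i) = i := fun i ↦ by
    apply hinj
    have h := conjAct_conjAct_of_mul_self W hcc ((2 ^ M : ℕ) : ℤ) (cs i)
    rw [hτs, map_zsmul, hτs, smul_smul, hss, one_smul] at h
    exact h
  -- ### exponents
  have hex : ∀ i, ((2 : ℤ) ^ Mi i) • cs i = 0 := fun i ↦ by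
    have h := addOrderOf_nsmul_eq_zero (cs i)
    rw [hMi i, ← natCast_zsmul] at h
    exact_mod_cast h
  have hexM : ∀ i, Mi i ≤ M := fun i ↦ by
    have hkill : ((2 ^ M : ℕ) : ℤ) • cs i = 0 := zsmul_galH1Torsion_eq_zero _ _ (cs i)
    have hdvd : addOrderOf (cs i) ∣ 2 ^ M := by
      apply addOrderOf_dvd_of_nsmul_eq_zero
      rw [← natCast_zsmul]; exact hkill
    rw [hMi i] at hdvd
    exact (Nat.pow_dvd_pow_iff_le_right (by norm_num)).mp hdvd
  have hind' : ∀ a : Fin r → ℤ, ∑ i, a i • cs i = 0 → ∀ i, ((2 : ℤ) ^ Mi i) ∣ a i := by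
    intro a ha i
    have h := hind a ha i
    rw [hMi i] at h
    exact_mod_cast h
  exact setInfinite_kolyvaginPrime_two_signStable (N := N) hC hK hM hS hCe hc₀ hfree₀ hc cs hπ hsgn
    hτs Mi hex hexM hind' hres Nv hNe hNπ


set_option maxHeartbeats 800000 in
/-- **Q5′ SIGNED, UNCONDITIONALLY: McCallum 1991 Cor. 3.2 at `p = 2` for signed-stable families**
(`c_* c_i = s_i • c_{π i}`, `s_i = ±1`, `s_{π i} = s_i`). The binders of
`equivariantChebotarevAtTwo_of_not_isSquare` (Q5 + the parent's `¬ IsSquare (d_K · (−|Δ_E|))`)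
verbatim, with `(sgn, hsgn, hsgnπ)` inserted after `π` and `hτs` signed. With `π = id`: for classes
`a_1, …, a_s` that are `c_*`-INVARIANT (restrictions of classes of `E` over `ℚ`) and `b_1, …, b_t`
that are `c_*`-ANTI-invariant (restrictions of classes of the twist `E^{(d_K)}` over `ℚ`), jointly
independent and meeting the inflation kernel trivially, and any `N ≤ ord` — infinitely many
Kolyvagin primes `ℓ` at `2` (`Frob ℓ = Frob ∞` on `K(E[2^M])`, `M ≤ M(ℓ)`) at whose place every
`a_i`, `b_j` has the prescribed local order: the `cebotarev` field of
`KolyvaginDescent.SplitHypothesesM` for the pair `(E, E^{(d_K)})` over `ℚ`, in `K_λ`-currency.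
[cite: McCallumLMS1991, §3 Cor. 3.2] [cite: GrossLMS1991, §9] [cite: Kolyvagin1989Izv, §3]
[cite: WZhang2014, Notations (xii)] -/
theorem equivariantChebotarevAtTwo_signed_of_not_isSquare
    (N : ℕ) [NeZero N] (W : WeierstrassCurve ℚ) [W.IsElliptic] [W.IsGloballyMinimal]
    (hcm : ¬ W.HasCM) (hΔ : W.Δ < 0) (K : Type) [Field K] [NumberField K]
    (hK : IsImaginaryQuadratic K) (hns : ¬ IsSquare ((NumberField.discr K : ℚ) * -|W.Δ|))
    (hρ : ∀ n : ℕ, W.HasSurjectiveModNGaloisRep (2 ^ n : ℕ)) (c : K ≃ₐ[ℚ] K) (hc : c ≠ 1)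
    (M : ℕ) (hM : 1 ≤ M) (r : ℕ) (cs : Fin r → galH1Torsion (W.baseChange K) ((2 ^ M : ℕ) : ℤ))
    (π : Fin r → Fin r) (sgn : Fin r → ℤ) (hsgn : ∀ i, sgn i = 1 ∨ sgn i = -1)
    (hsgnπ : ∀ i, sgn (π i) = sgn i) (h0 : ∀ i, cs i ≠ 0)
    (hτs : ∀ i, conjAct W c ((2 ^ M : ℕ) : ℤ) (cs i) = sgn i • cs (π i))
    (hind : ∀ a : Fin r → ℤ, ∑ i, a i • cs i = 0 → ∀ i, (addOrderOf (cs i) : ℤ) ∣ a i)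
    (hres : ∀ a : Fin r → ℤ, (∀ ρ ∈ torsionFixing (W.baseChange K) ((2 ^ M : ℕ) : ℤ),
      h1Eval (W.baseChange K) ((2 ^ M : ℕ) : ℤ) (∑ i, a i • cs i) ρ = 0) → ∑ i, a i • cs i = 0)
    (Mi : Fin r → ℕ) (hMi : ∀ i, addOrderOf (cs i) = 2 ^ Mi i) (Nv : Fin r → ℕ)
    (hNe : ∀ i, Nv i ≤ Mi i) (hNπ : ∀ i, Nv (π i) = Nv i) :
    Set.Infinite {ℓ : ℕ | FrobEqFrobInfty W K (2 ^ M) ℓ ∧ Zhang2014.IsKolyvaginPrime N W K 2 ℓ ∧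
      M ≤ Zhang2014.kolyvaginIndex W 2 ℓ ∧
      ∀ i, ∀ v : HeightOneSpectrum (𝓞 K), (ℓ : 𝓞 K) ∈ v.asIdeal → ∀ j : ℕ,
        ((2 ^ j : ℕ) : ℤ) • cs i ∈
            (W.baseChange K).torsionLocalKer (v.adicCompletion K) ((2 ^ M : ℕ) : ℤ) ↔ Nv i ≤ j} := by
  have hsurj : W.HasSurjectiveModNGaloisRep 2 := by simpa using hρ 1
  have habs : -|W.Δ| = W.Δ := by rw [abs_of_neg hΔ, neg_neg]
  rw [habs] at hns
  obtain ⟨hS, hCe⟩ := image_two_of_not_isSquare W K hK.1 hsurj hns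
  exact equivariantChebotarevAtTwo_signed_of_image Automorphic.chebotarev_artinRep_of_galoisSide
    N W hcm hΔ K hK hS hCe hρ c hc M hM r cs π sgn hsgn hsgnπ h0 hτs hind hres Mi hMi Nv hNe hNπ

/-- **The mixed-family corollary (`π = id`)**: Čebotarev at `2` for a family of `c_*`-EIGENCLASSES of
both signs in `H¹(K, E[2^M])` — `c_* c_i = s_i c_i`, `s_i = ±1` — on `Δ(E) < 0`, `K ≠ ℚ(√Δ_E)`,
`ρ_{E,2^∞}` onto: exactly McCallum's printed Cor. 3.2 ("independent eigenclasses `c·c_i = ±c_i`")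
at `p = 2`, and the Čebotarev input of Kolyvagin's descent over `ℚ` for the pair `(E, E^{(d_K)})`.
[cite: McCallumLMS1991, §3 Cor. 3.2] [cite: Kolyvagin1989Izv, §3] -/
theorem equivariantChebotarevAtTwo_eigen_of_not_isSquare
    (N : ℕ) [NeZero N] (W : WeierstrassCurve ℚ) [W.IsElliptic] [W.IsGloballyMinimal]
    (hcm : ¬ W.HasCM) (hΔ : W.Δ < 0) (K : Type) [Field K] [NumberField K]
    (hK : IsImaginaryQuadratic K) (hns : ¬ IsSquare ((NumberField.discr K : ℚ) * -|W.Δ|))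
    (hρ : ∀ n : ℕ, W.HasSurjectiveModNGaloisRep (2 ^ n : ℕ)) (c : K ≃ₐ[ℚ] K) (hc : c ≠ 1)
    (M : ℕ) (hM : 1 ≤ M) (r : ℕ) (cs : Fin r → galH1Torsion (W.baseChange K) ((2 ^ M : ℕ) : ℤ))
    (sgn : Fin r → ℤ) (hsgn : ∀ i, sgn i = 1 ∨ sgn i = -1) (h0 : ∀ i, cs i ≠ 0)
    (hτs : ∀ i, conjAct W c ((2 ^ M : ℕ) : ℤ) (cs i) = sgn i • cs i)
    (hind : ∀ a : Fin r → ℤ, ∑ i, a i • cs i = 0 → ∀ i, (addOrderOf (cs i) : ℤ) ∣ a i)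
    (hres : ∀ a : Fin r → ℤ, (∀ ρ ∈ torsionFixing (W.baseChange K) ((2 ^ M : ℕ) : ℤ),
      h1Eval (W.baseChange K) ((2 ^ M : ℕ) : ℤ) (∑ i, a i • cs i) ρ = 0) → ∑ i, a i • cs i = 0)
    (Mi : Fin r → ℕ) (hMi : ∀ i, addOrderOf (cs i) = 2 ^ Mi i) (Nv : Fin r → ℕ)
    (hNe : ∀ i, Nv i ≤ Mi i) :
    Set.Infinite {ℓ : ℕ | FrobEqFrobInfty W K (2 ^ M) ℓ ∧ Zhang2014.IsKolyvaginPrime N W K 2 ℓ ∧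
      M ≤ Zhang2014.kolyvaginIndex W 2 ℓ ∧
      ∀ i, ∀ v : HeightOneSpectrum (𝓞 K), (ℓ : 𝓞 K) ∈ v.asIdeal → ∀ j : ℕ,
        ((2 ^ j : ℕ) : ℤ) • cs i ∈
            (W.baseChange K).torsionLocalKer (v.adicCompletion K) ((2 ^ M : ℕ) : ℤ) ↔ Nv i ≤ j} :=
  equivariantChebotarevAtTwo_signed_of_not_isSquare N W hcm hΔ K hK hns hρ c hc M hM r cs id sgn hsgn
    (fun _ ↦ rfl) h0 hτs hind hres Mi hMi Nv hNe (fun _ ↦ rfl)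

end Summit.BirchSwinnertonDyer.BirchSwinnertonDyer.Theorems.GenusExact

end
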